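import Summits.CriticalPhenomena.PercolationContinuityZ3.Theorems.Transplant.SkelPhiEquilibriumB
import Summits.CriticalPhenomena.PercolationContinuityZ3.Theorems.Transplant.SkelPhiStepINegPairs
import HarnessLib

/-!
# N1 (the {±1} node), LEVEL 0, file (L0-5, part 3): **STEP I″ WITH ORIENTATION** — `Skelφ.StepI.exists_stepI_negO`: two Step-I″ records sharing the zone family, seed level,
# radius and thresholds — `D` for the skeleton map `φ` and `DT` for its transpose `trφ φ` — and an orientation bit `ori t M n` such that at every admissible `(t, M, n)` the
# record of the CHOSEN orientation satisfies the geometric clause, the SHEAR BOUND `|h| ≤ 10·n`, and has its eight piece-links likely (zones are orientation-free)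

How LEVEL 1 consumes it (NEG-SCOPE B.8): every LEVEL-1 file is stated for an arbitrary two-axis dictionary; at `(t, M, n)` with `ori t M n = true` instantiate at `(φ, D)`, else at
`(trφ φ, DT)` (`lip_trφ/steps_trφ/frames_trφ/cylConn_trφ/cylSubcritical_trφ/neg_trφ` supply the dictionary); in both cases `κ = |hgt|/n ≤ 10`.
The seed/radius data of `φ` serve both orientations (`cyl`, `cylBall`, `cylReach` are transposition-invariant: §1).
builds on p205010 (kernel theorem, internal audit signed; external expert review pending) — nothing here uses p205010; nothing is claimed about the open node
`SamePDropOfSkeletonNeg`.  Lane `prim-bschramm`, seat `prim-bschramm-p3` (gen 8; design owner); helper file (`--supports stmt-CriticalPhenomena-4575`).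
[cite: MartineauTassion2017, §3.2 Lemma 3.5, §3.3 Lemma 3.7] [cite: KozmaNitzan2024, §4 p. 17 (Step I)] [this work]
-/

noncomputable section

namespace Summit.CriticalPhenomena.PercolationContinuityZ3.Theorems.Transplant

namespace Skelφ

open MeasureTheory ProbabilityTheory Filter Topology Literature.Probability.Percolation Literature.Probability.LatticeModels SimpleGraph KNLevels
open Literature.Barriers.CriticalPhenomena (graphBall)
open scoped Classical

variable {V : Type} {G : SimpleGraph V} {φ : V → Site 2}

/-! ## §1 Fat balls and cylinder tails are transposition-invariant -/

/-- Images of graph balls of induced graphs depend only on the inducing set. [folklore] -/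
theorem image_graphBall_induce_congr [G.LocallyFinite] {S S' : Set V} (e : S = S') (t : V) (h : t ∈ S) (h' : t ∈ S') (R : ℕ) :
    Subtype.val '' graphBall (G.induce S) ⟨t, h⟩ R = Subtype.val '' graphBall (G.induce S') ⟨t, h'⟩ R := by
  subst e; rfl

/-- `cylBall` is transposition-invariant. [folklore] -/
theorem cylBall_trφ [G.LocallyFinite] (t : V) (ℓ R : ℕ) : cylBall G (trφ φ) t ℓ R = cylBall G φ t ℓ R :=
  image_graphBall_induce_congr (cyl_trφ φ t ℓ) t _ _ R

/-- `cylFar` is transposition-invariant. [folklore] -/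
theorem cylFar_trφ [G.LocallyFinite] (t : V) (n R : ℕ) : cylFar G (trφ φ) t n R = cylFar G φ t n R := by
  ext v; simp only [cylFar, Set.mem_setOf_eq, cylBall_trφ]

/-- `cylReach` is transposition-invariant. [folklore] -/
theorem cylReach_trφ [G.LocallyFinite] (t : V) (n R : ℕ) (a : V) : cylReach G (trφ φ) t n R a = cylReach G φ t n R a := by
  ext ω; simp only [cylReach, Set.mem_setOf_eq, cylFar_trφ, cyl_trφ]

namespace StepI

/-! ## §2 Thresholds with the shear bound, for either orientation, over the seed of `φ` -/

/-- **Thresholds for a dictionary map `ψ ∈ {φ, φᵀ}` over `φ`'s fat seed and fat radius**: `ψ` is any two-axis dictionary whose cylinders, fat balls and cylinder tails are those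
of `φ` (e.g. `ψ = φ` or `ψ = trφ φ`); output `EquilibriumAtWB G ψ …` at every admissible `(M, n)` with `¬ Good^ψ(n,0,3n)`. [cite: MartineauTassion2017, §3.2 Lemma 3.5] -/
theorem exists_thresholds_of_seedO [Countable V] [G.LocallyFinite] {types : Finset V} (hc : G.Preconnected) {ψ : V → Site 2} (hlip : Lip G ψ) (hst : Steps G ψ)
    (hfrψ : Frames G ψ types) (hfr : Frames G φ types) {p : unitInterval} (hCψ : CylSubcritical G ψ types p) (hC : CylSubcritical G φ types p)
    (hcyl : ∀ t n, cyl ψ t n = cyl φ t n) (hball : ∀ t n R, cylBall G ψ t n R = cylBall G φ t n R)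
    (hreach : ∀ t n R a, cylReach G ψ t n R a = cylReach G φ t n R a) (hp0 : 0 < (p : ℝ)) (hp1 : (p : ℝ) < 1)
    (hU : ∀ᵐ ω ∂bondPercolation G p, numInfiniteClusters ω ≤ 1) {t : V} (ht : t ∈ types) {ρ : G ≃g G} (hρt : ρ t = t)
    (hρψ : ∀ w, ψ (ρ w) - ψ t = -(ψ w - ψ t)) (hρφ : ∀ w, φ (ρ w) - φ t = -(φ w - φ t)) {ε : ℝ} (hε0 : 0 < ε) (hε1 : ε < 1) {k : ℕ} (hk1 : 1 ≤ k)
    (hseed : 1 - (ε / 2) ^ 32 ≤ (bondPercolation G p).real (TwoAxis.SeedPerc (↑(fatSeq hfr hC t k) : Set V))) :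
    ∃ (M₀ : ℕ) (n₁ : ℕ → ℕ), k ≤ M₀ ∧ ∀ M, M₀ ≤ M → ∀ n, n₁ M ≤ n → ¬ Eq.Good G ψ t p ↑(fatSeq hfr hC t k) n 0 (3 * n) →
      EquilibriumAtWB G ψ p t (fatSeq hfr hC t k) M (fatRadius hfr hC) ε n := by
  set μ := bondPercolation G p with hμ
  have hε2 : 0 < ε / 2 := by positivity
  have hε21 : ε / 2 < 1 := by linarith
  obtain ⟨m, hm⟩ := exists_pow_lt_of_lt_one hε2 (show (1 / 2 : ℝ) < 1 by norm_num)
  set M₀ : ℕ := max (k + 1) m with hM₀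
  have key : ∀ M, ∃ n₁ : ℕ, M₀ ≤ M → ∀ n, n₁ ≤ n → ¬ Eq.Good G ψ t p ↑(fatSeq hfr hC t k) n 0 (3 * n) →
      EquilibriumAtWB G ψ p t (fatSeq hfr hC t k) M (fatRadius hfr hC) ε n := by
    intro M
    by_cases hM : M₀ ≤ M
    swap
    · exact ⟨0, fun h => absurd h hM⟩
    have hkM : k + 1 ≤ M := le_trans (le_max_left _ _) hM
    have hmM : m ≤ M := le_trans (le_max_right _ _) hM
    have hSM : (↑(fatSeq hfr hC t k) : Set V) ⊆ cyl ψ t M := by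
      rw [hcyl]; exact (fatSeq_subset_cyl hfr hC t k).trans (cyl_mono φ t (by omega))
    have hQx : ∀ σu : ℤˣ, Eq.MeetsAS G p (Eq.Xinf ψ t (σu : ℤ) (M + 3))ᶜ := fun σu =>
      meetsAS_compl_Xinf hc hfrψ hst hlip hU t (by rcases Int.units_eq_one_or σu with h | h <;> simp [h]) (M + 3)
    have htail : ∀ L, M ≤ L → μ.real (⋃ b ∈ fatSeq hfr hC t k, cylReach G ψ t L (fatRadius hfr hC L - 1) b) ≤ ε / 2 := by
      intro L hL
      have h1 := real_biUnion_cylReach_fat_le hfr hC ht (n := L) (by omega) (Eq.fatSeq_subset_fatSeq hfr hC t (show k ≤ L - 1 by omega))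
      have h2 : (1 / 2 : ℝ) ^ L ≤ (1 / 2) ^ m := pow_le_pow_of_le_one (by norm_num) (by norm_num) (by omega)
      simp only [hreach]
      linarith
    obtain ⟨n₁, hn₁⟩ := Eq.exists_equilibriumWB (t := t) hlip hst hfrψ hCψ hp0 hp1 hρt hρψ (M := M) (by omega) (fatSeq hfr hC t k)
      ((mem_fatSeq_iff hfr hC).2 (self_mem_cylBall G φ t k _)) hSM (Eq.preimage_fatSeq_of_neg hfr hC hρt hρφ k)
      (fun n => meetsAS_compl_strip hc hfrψ hst hlip hU t n) hQx hε2 hε21 hseed (fatRadius hfr hC)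
      (fun L hL => le_trans (by omega) (le_fatRadius hfr hC L))
      (fun L hL v hv => by
        rw [hball]; exact cylBall_mono G φ t (by omega) (fatRadius_mono hfr hC (by omega)) ((mem_fatSeq_iff hfr hC).1 (Finset.mem_coe.1 hv)))
      htail
    refine ⟨n₁, fun _ n hn hng => ?_⟩
    have := hn₁ n hn hng
    rwa [add_halves] at this
  choose n₁ hn₁ using key
  exact ⟨M₀, n₁, le_trans (Nat.le_succ _) (le_max_left _ _), fun M hM n hn => hn₁ M hM n hn⟩

/-- The equilibrium triple chosen from `EquilibriumAtWB` (default `(0,0,0)`). [this work] -/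
def eqTripleB (G : SimpleGraph V) [G.LocallyFinite] (ψ : V → Site 2) (p : unitInterval) (SEED : V → Finset V) (R : ℕ → ℕ) (ε : ℝ) (t : V) (M n : ℕ) :
    ℤ × ℕ × ℤ :=
  if H : EquilibriumAtWB G ψ p t (SEED t) M R ε n then (H.choose, H.choose_spec.choose, H.choose_spec.choose_spec.choose) else (0, 0, 0)

/-- Unpacking a record built from `eqTripleB` at a point where `EquilibriumAtWB` holds: geometric clause, shear bound, eight likely links. [folklore] -/
theorem eqTripleB_spec [G.LocallyFinite] {ψ : V → Site 2} {p : unitInterval} {Λ : V → ℕ → Finset V} {k : ℕ} {R : ℕ → ℕ} {ε : ℝ} {M₀ : ℕ} {n₁ : ℕ → ℕ}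
    {t : V} {M n : ℕ} (H : EquilibriumAtWB G ψ p t (Λ t k) M R ε n) :
    let D : DataN V := ⟨Λ, k, R, M₀, n₁, fun t M n => (eqTripleB G ψ p (fun t => Λ t k) R ε t M n).1,
      fun t M n => (eqTripleB G ψ p (fun t => Λ t k) R ε t M n).2.1, fun t M n => (eqTripleB G ψ p (fun t => Λ t k) R ε t M n).2.2⟩
    D.EqGeom G ψ t M n ∧ (D.hgt t M n).natAbs ≤ 10 * n ∧
      ∀ (fam : Fin 2) (σ τ : ℤˣ), 1 - ε ≤ (bondPercolation G p).real (eventN G ψ D (t, M, some (n, fam, σ, τ))) := by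
  intro D
  have hTe : eqTripleB G ψ p (fun t => Λ t k) R ε t M n = (H.choose, H.choose_spec.choose, H.choose_spec.choose_spec.choose) := by
    rw [eqTripleB, dif_pos H]
  have hs := H.choose_spec.choose_spec.choose_spec
  have h1 : D.hgt t M n = H.choose := by simp only [D, hTe]
  have h2 : D.len t M n = H.choose_spec.choose := by simp only [D, hTe]
  have h3 : D.spl t M n = H.choose_spec.choose_spec.choose := by simp only [D, hTe]
  obtain ⟨hκ, hrest⟩ := hs
  have hgl := DataN.eqGeom_and_links (G := G) (φ := ψ) (p := p) (D := D) (t := t) (M := M) (n := n) (ε := ε) (by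
    rw [regionN, DataN.scale, h1, h2, h3]; exact hrest)
  exact ⟨hgl.1, by rw [h1]; exact hκ, hgl.2⟩

/-! ## §3 Step I″ with orientation -/

/-- **STEP I″ WITH ORIENTATION.** [cite: MartineauTassion2017, §3.3 Lemma 3.7] [cite: KozmaNitzan2024, §4 p. 17 (Step I)] [this work] -/
theorem exists_stepI_negO [Countable V] [G.LocallyFinite] {types : Finset V} (hc : G.Preconnected) (hlip : Lip G φ) (hst : Steps G φ)
    (hfr : Frames G φ types) (hκ : CylConn G φ types) {p : unitInterval} (hC : CylSubcritical G φ types p) (hp0 : 0 < (p : ℝ)) (hp1 : (p : ℝ) < 1)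
    (hU : ∀ᵐ ω ∂bondPercolation G p, numInfiniteClusters ω ≤ 1) {z : V} (hθ : 0 < theta G z p)
    (hneg : ∀ t ∈ types, ∃ ρ : G ≃g G, ρ t = t ∧ ∀ w, φ (ρ w) - φ t = -(φ w - φ t)) {δ : ℝ} (hδ0 : 0 < δ) (hδ1 : δ < 1) (m₀ : ℕ) :
    ∃ (D DT : DataN V) (ori : V → ℕ → ℕ → Bool),
      m₀ ≤ D.k ∧ 1 ≤ D.k ∧ D.k ≤ D.M₀ ∧ D.R = fatRadius hfr hC ∧ D.Λ = fatSeq hfr hC ∧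
      DT.Λ = D.Λ ∧ DT.k = D.k ∧ DT.R = D.R ∧ DT.M₀ = D.M₀ ∧ DT.n₁ = D.n₁ ∧
      (∀ t ∈ types, ∀ M, D.M₀ ≤ M → 1 - δ < (bondPercolation G p).real (eventN G φ D (t, M, none))) ∧
      (∀ t ∈ types, ∀ M, D.M₀ ≤ M → ∀ n, D.n₁ M ≤ n →
        (ori t M n = true → D.EqGeom G φ t M n ∧ (D.hgt t M n).natAbs ≤ 10 * n ∧
          ∀ (fam : Fin 2) (σ τ : ℤˣ), 1 - δ ≤ (bondPercolation G p).real (eventN G φ D (t, M, some (n, fam, σ, τ)))) ∧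
        (ori t M n = false → DT.EqGeom G (trφ φ) t M n ∧ (DT.hgt t M n).natAbs ≤ 10 * n ∧
          ∀ (fam : Fin 2) (σ τ : ℤˣ), 1 - δ ≤ (bondPercolation G p).real (eventN G (trφ φ) DT (t, M, some (n, fam, σ, τ))))) := by
  set μ := bondPercolation G p with hμ
  -- one seed level for all base vertices
  obtain ⟨k, hkm, hk⟩ := exists_seed_scale hfr hC hκ hθ (η := (δ / 2) ^ 32) (by positivity) (max m₀ 1)
  have hk1 : 1 ≤ k := le_trans (le_max_right _ _) hkm
  have hseed : ∀ t ∈ types, 1 - (δ / 2) ^ 32 ≤ μ.real (TwoAxis.SeedPerc (↑(fatSeq hfr hC t k) : Set V)) := fun t ht => by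
    have := hk t ht 0; rw [fatSeqOff_zero] at this; exact this.le
  have hδ32 : (δ / 2) ^ 32 < 1 := pow_lt_one₀ (by positivity) (by linarith) (by norm_num)
  -- per-type thresholds, both orientations
  have hthr : ∀ t, ∃ (M₀ : ℕ) (n₁ : ℕ → ℕ), t ∈ types → k ≤ M₀ ∧
      (∀ M, M₀ ≤ M → ∀ n, n₁ M ≤ n → ¬ Eq.Good G φ t p ↑(fatSeq hfr hC t k) n 0 (3 * n) →
        EquilibriumAtWB G φ p t (fatSeq hfr hC t k) M (fatRadius hfr hC) δ n) ∧
      (∀ M, M₀ ≤ M → ∀ n, n₁ M ≤ n → ¬ Eq.Good G (trφ φ) t p ↑(fatSeq hfr hC t k) n 0 (3 * n) →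
        EquilibriumAtWB G (trφ φ) p t (fatSeq hfr hC t k) M (fatRadius hfr hC) δ n) := by
    intro t
    by_cases ht : t ∈ types
    · obtain ⟨ρ, hρt, hρφ⟩ := hneg t ht
      obtain ⟨M₁, n₁, hkM₁, h₁⟩ := exists_thresholds_of_seedO hc hlip hst hfr hfr hC hC (fun _ _ => rfl) (fun _ _ _ => rfl) (fun _ _ _ _ => rfl)
        hp0 hp1 hU ht hρt hρφ hρφ hδ0 hδ1 hk1 (hseed t ht)
      obtain ⟨M₂, n₂, hkM₂, h₂⟩ := exists_thresholds_of_seedO hc (lip_trφ hlip) (steps_trφ hst) (frames_trφ hfr) hfr (cylSubcritical_trφ hC) hC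
        (fun t n => cyl_trφ φ t n) (fun t n R => cylBall_trφ t n R) (fun t n R a => cylReach_trφ t n R a) hp0 hp1 hU ht hρt (neg_trφ hρφ) hρφ
        hδ0 hδ1 hk1 (hseed t ht)
      refine ⟨max M₁ M₂, fun M => max (n₁ M) (n₂ M), fun _ => ⟨hkM₁.trans (le_max_left _ _), fun M hM n hn hng => ?_, fun M hM n hn hng => ?_⟩⟩
      · exact h₁ M (le_trans (le_max_left _ _) hM) n (le_trans (le_max_left _ _) hn) hng
      · exact h₂ M (le_trans (le_max_right _ _) hM) n (le_trans (le_max_right _ _) hn) hng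
    · exact ⟨0, fun _ => 0, fun h => absurd h ht⟩
  choose M₀ n₁ hthr using hthr
  -- per-type zone thresholds
  have hzone : ∀ t, ∃ Mz : ℕ, t ∈ types → ∀ M, Mz ≤ M → 1 - δ < μ.real (UniqZone.zone G (fatSeq hfr hC t) k M) := by
    intro t
    by_cases ht : t ∈ types
    · obtain ⟨Mz, hMz⟩ := UniqZone.exists_forall_le_lt_real_zone p hU (fatSeq_nest hlip hfr hC t) (fatSeq_monotone hfr hC t)
        (fatSeq_exhaust hκ hfr hC ht) k hδ0
      exact ⟨Mz, fun _ => hMz⟩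
    · exact ⟨0, fun h => absurd h ht⟩
  choose Mz hMz using hzone
  -- the records
  set MM : ℕ := types.sup M₀ + types.sup Mz + k with hMM
  set NN : ℕ → ℕ := fun M => (types.sup fun t => n₁ t M) + M + 1 with hNN
  set T : V → ℕ → ℕ → ℤ × ℕ × ℤ := eqTripleB G φ p (fun t => fatSeq hfr hC t k) (fatRadius hfr hC) δ with hT
  set TT : V → ℕ → ℕ → ℤ × ℕ × ℤ := eqTripleB G (trφ φ) p (fun t => fatSeq hfr hC t k) (fatRadius hfr hC) δ with hTT
  set D : DataN V := ⟨fatSeq hfr hC, k, fatRadius hfr hC, MM, NN, fun t M n => (T t M n).1, fun t M n => (T t M n).2.1, fun t M n => (T t M n).2.2⟩ with hD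
  set DT : DataN V := ⟨fatSeq hfr hC, k, fatRadius hfr hC, MM, NN, fun t M n => (TT t M n).1, fun t M n => (TT t M n).2.1,
    fun t M n => (TT t M n).2.2⟩ with hDT
  set ori : V → ℕ → ℕ → Bool := fun t M n => decide (¬ Eq.Good G φ t p ↑(fatSeq hfr hC t k) n 0 (3 * n)) with hori
  refine ⟨D, DT, ori, le_trans (le_max_left _ _) hkm, hk1, Nat.le_add_left _ _, rfl, rfl, rfl, rfl, rfl, rfl, rfl, fun t ht M hM => ?_,
    fun t ht M hM n hn => ?_⟩
  · rw [eventN_none]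
    exact hMz t ht M (le_trans (le_trans (Finset.le_sup (f := Mz) ht) (Nat.le_add_left _ _)) (le_trans (Nat.le_add_right _ _) hM))
  · have hM' : M₀ t ≤ M := le_trans (le_trans (Finset.le_sup (f := M₀) ht) (Nat.le_add_right _ _)) (le_trans (Nat.le_add_right _ _) hM)
    have hn' : n₁ t M ≤ n := le_trans (le_trans (Finset.le_sup (f := fun t => n₁ t M) ht) (Nat.le_add_right _ _)) (le_trans (Nat.le_add_right _ _) hn)
    have hMn : M < n := by have : NN M ≤ n := hn; simp only [hNN] at this; omega
    have hn1 : 1 ≤ n := by omega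
    have hkM : k ≤ M := le_trans (Nat.le_add_left _ _) hM
    -- the orientation lemma at `(t, M, n)`
    have hSM : (↑(fatSeq hfr hC t k) : Set V) ⊆ cyl φ t M := (fatSeq_subset_cyl hfr hC t k).trans (cyl_mono φ t hkM)
    have hSR : (↑(fatSeq hfr hC t k) : Set V) ⊆ cylBall G φ t (pgScale n 0 (3 * n)) (fatRadius hfr hC k) := fun v hv =>
      cylBall_mono G φ t (le_trans (by omega : k ≤ n) (le_max_left _ _)) le_rfl ((mem_fatSeq_iff hfr hC).1 (Finset.mem_coe.1 hv))
    have hperc : 0 < μ.real (TwoAxis.SeedPerc (↑(fatSeq hfr hC t k) : Set V)) := lt_of_lt_of_le (by linarith) (hseed t ht)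
    have hor := Eq.orientation' (t := t) hlip hfr hC hp1 hn1 (fatSeq hfr hC t k) hMn hSM hSR hperc
    constructor
    · intro hot
      have hng : ¬ Eq.Good G φ t p ↑(fatSeq hfr hC t k) n 0 (3 * n) := by simpa [hori] using hot
      have H := (hthr t ht).2.1 M hM' n hn' hng
      exact eqTripleB_spec (Λ := fatSeq hfr hC) (M₀ := MM) (n₁ := NN) H
    · intro hof
      have hg : Eq.Good G φ t p ↑(fatSeq hfr hC t k) n 0 (3 * n) := by simpa [hori] using hof
      have hng : ¬ Eq.Good G (trφ φ) t p ↑(fatSeq hfr hC t k) n 0 (3 * n) := hor.resolve_left (not_not.2 hg)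
      have H := (hthr t ht).2.2 M hM' n hn' hng
      exact eqTripleB_spec (Λ := fatSeq hfr hC) (M₀ := MM) (n₁ := NN) H

end StepI

end Skelφ

end Summit.CriticalPhenomena.PercolationContinuityZ3.Theorems.Transplant

end
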